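import Summits.Parity.GeneralizedHardyLittlewood.Theorems.Dhl42Integrability
import Summits.Parity.GeneralizedHardyLittlewood.Theorems.Dhl42DefsCover

/-!
# DHL[42,2] certificate — measurability of `Ω'` and `E_m`; integrability of the cross-term integrands

§E: `t ↦ U_t(u)` is measurable, hence so are `Ω' = OmegaG` and the 126 members `Esets m` of Section
7.3; `N_β` is measurable and `≤ 42`, the bins `binSet` are measurable, the fibre length `ℓ_{mβ}`
(`lenJI`) is a measurable section measure bounded by `S`; so the integrands of `Aval m β` (on `E_m`)
and `Bval m β` (on `Ω'`) of eq. (15)/(17) are integrable for every measurable bin, in particular for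
the bins of any bin family; and the summary `certificateIntegrands_integrable`: every integral named
by the certificate hypotheses C1–C4 (`Ival`, `JKval`, `LGval`, `Aval`, `Bval`) is the Bochner
integral of an integrable function, never Mathlib's junk value.

Origin: `Dhl42/Integrability.lean` of the DHL[42,2] certificate package (pub-dhl42 bundle, archive
blob `18cce9e3`; sha256[:16] of the file `f2fc1acc19a920b3`; paper snapshot = `paper/main.tex` v1),
lines :304–:467; statements and proofs unchanged except: namespace `TpY4Dhl42` →
`Summit.Parity.GeneralizedHardyLittlewood.Theorems.Dhl42`, the package's `simplexSet n B` replaced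
by the tree's definitionally equal `Literature.NumberTheory.Sieve.scaledSimplex n B` (also inside
declaration names), docstrings added where missing (the docstring of
`certificateIntegrands_integrable` re-worded for the tree: package-internal pointers removed,
mathematics unchanged), `#print axioms` lines dropped. Package-internal references in the verbatim
docstrings (`Dhl42/….lean`, `Assumed.…`, `row 9…`, `gen n`, `inputs/COMPARE.md`) refer to that
package (paper Appendix B).

Declarations (18): `measurable_bigU`, `measurableSet_OmegaG`, `measurableSet_Esets`,
`measurableSet_binSet`, `Nbin_real_eq`, `measurable_Nbin_real`, `Nbin_le`, `integrableOn_Aval`,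
`lenSet`, `measurableSet_lenSet`, `lenJI_eq`, `measurable_lenJI`, `lenJI_le`, `OmegaG_subset`,
`integrableOn_Bval`, `integrableOn_Aval_binSet`, `integrableOn_Bval_binSet`,
`certificateIntegrands_integrable`.
-/

open MeasureTheory Set
open Literature.NumberTheory.Sieve (scaledSimplex measurableSet_scaledSimplex volume_scaledSimplex_lt_top)

namespace Summit.Parity.GeneralizedHardyLittlewood.Theorems.Dhl42

noncomputable section

/-! ### E. The cross-term integrands `F0² · N_β` on `E_m` and `F0marg² · ℓ_{mβ}` on `Ω'` -/

/-- For each level `u`, `t ↦ U_t(u)` is measurable (a finite sum of measurable `if`-terms). -/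
theorem measurable_bigU {n : ℕ} (u : ℝ) : Measurable fun t : Fin n → ℝ => bigU t u := by
  unfold bigU
  exact Finset.measurable_sum _ fun j _ =>
    Measurable.ite (measurableSet_le measurable_const (measurable_pi_apply j))
      (measurable_pi_apply j) measurable_const

/-- `Ω' = OmegaG` is Lebesgue measurable: `K·R₄₁` cut by finitely many constraints on the coordinate
sum and on the measurable functions `t ↦ U_t(u_l)`. -/
theorem measurableSet_OmegaG : MeasurableSet OmegaG := by
  have h : ∀ g : Fin 3, MeasurableSet {t : Fin 41 → ℝ |
      (∑ j, t j) ≤ Kc - eps2 g ∨ ∀ l : Fin 54, bigU t (uvec l) ≤ tauGband g l} := fun g => by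
    have h2 : MeasurableSet (⋂ l : Fin 54, {t : Fin 41 → ℝ | bigU t (uvec l) ≤ tauGband g l}) :=
      MeasurableSet.iInter fun l => measurableSet_le (measurable_bigU _) measurable_const
    have e : {t : Fin 41 → ℝ | ∀ l : Fin 54, bigU t (uvec l) ≤ tauGband g l} =
        ⋂ l : Fin 54, {t : Fin 41 → ℝ | bigU t (uvec l) ≤ tauGband g l} := by
      ext t; simp
    have h3 : MeasurableSet {t : Fin 41 → ℝ | ∀ l : Fin 54, bigU t (uvec l) ≤ tauGband g l} := by
      rw [e]; exact h2
    exact (measurableSet_le (measurable_sum_coord 41) measurable_const).union h3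
  have : OmegaG = scaledSimplex 41 Kc ∩ ⋂ g, {t : Fin 41 → ℝ |
      (∑ j, t j) ≤ Kc - eps2 g ∨ ∀ l : Fin 54, bigU t (uvec l) ≤ tauGband g l} := by
    ext t; simp [OmegaG]
  rw [this]
  exact (measurableSet_scaledSimplex 41 Kc).inter (MeasurableSet.iInter h)

/-- Every cover member `Esets m` (Section 7.3) is Lebesgue measurable. -/
theorem measurableSet_Esets (m : Member) : MeasurableSet (Esets m) := by
  rcases m with ⟨g, l⟩ | l
  · change MeasurableSet {t ∈ scaledSimplex 42 Sc |
        inBand g (∑ j, t j) ∧ tauFband g (toU l) < bigU t (uvec (toU l)) ∧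
          bigU t (uvecE (toU l).succ) ≤ tauFbandE g (toU l).succ}
    refine (measurableSet_scaledSimplex 42 Sc).inter ?_
    refine MeasurableSet.inter ?_ (MeasurableSet.inter ?_ ?_)
    · exact (measurableSet_le measurable_const (measurable_const.sub (measurable_sum_coord 42))).inter
        (measurableSet_lt (measurable_const.sub (measurable_sum_coord 42)) measurable_const)
    · exact measurableSet_lt measurable_const (measurable_bigU _)
    · exact measurableSet_le (measurable_bigU _) measurable_const
  · change MeasurableSet {t ∈ scaledSimplex 42 Sc |
        Sc - eps2 0 < ∑ j, t j ∧
          tauFband 0 (Fin.castLE (by omega) l) < bigU t (uvec (Fin.castLE (by omega) l))}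
    refine (measurableSet_scaledSimplex 42 Sc).inter ?_
    exact (measurableSet_lt measurable_const (measurable_sum_coord 42)).inter
      (measurableSet_lt measurable_const (measurable_bigU _))

/-- The bins of a bin family are the intervals `[b_i, b_{i+1})`, hence measurable. -/
theorem measurableSet_binSet {t0 : ℝ} (mb : MemberBins t0) (i : Fin mb.n) :
    MeasurableSet (binSet mb i) :=
  measurableSet_Ico

/-- `N_β(t) = Σ_m 1_β(t_m)` as a real number. -/
theorem Nbin_real_eq (β : Set ℝ) (t : Fin 42 → ℝ) :
    (Nbin β t : ℝ) = ∑ m : Fin 42, β.indicator (fun _ => (1 : ℝ)) (t m) := by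
  classical
  unfold Nbin
  rw [Finset.natCast_card_filter]
  refine Finset.sum_congr rfl fun m _ => ?_
  by_cases hm : t m ∈ β
  · rw [if_pos hm, indicator_of_mem hm]
  · rw [if_neg hm, indicator_of_notMem hm]

/-- `t ↦ N_β(t)` (as a real number) is measurable for a measurable bin `β`. -/
theorem measurable_Nbin_real {β : Set ℝ} (hβ : MeasurableSet β) :
    Measurable fun t : Fin 42 → ℝ => (Nbin β t : ℝ) := by
  have e : (fun t : Fin 42 → ℝ => (Nbin β t : ℝ)) =
      fun t => ∑ m : Fin 42, β.indicator (fun _ => (1 : ℝ)) (t m) := funext (Nbin_real_eq β)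
  rw [e]
  exact Finset.measurable_sum _ fun m _ =>
    (measurable_const.indicator hβ).comp (measurable_pi_apply m)

/-- `N_β(t) ≤ 42`: at most all coordinates are counted. -/
theorem Nbin_le (β : Set ℝ) (t : Fin 42 → ℝ) : Nbin β t ≤ 42 := by
  classical
  unfold Nbin
  exact le_trans (Finset.card_filter_le _ _) (by simp)

/-- The integrand of `Aval m β` is integrable on `E_m`, for every measurable bin `β`. -/
theorem integrableOn_Aval (m : Member) {β : Set ℝ} (hβ : MeasurableSet β) :
    IntegrableOn (fun t => F0 t ^ 2 * (Nbin β t : ℝ)) (Esets m) := by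
  obtain ⟨C, hC0, hC⟩ := exists_bound_F0
  have hsub : Esets m ⊆ scaledSimplex 42 Sc := by
    rcases m with ⟨g, l⟩ | l <;> exact fun _ ht => ht.1
  refine Measure.integrableOn_of_bounded (M := C ^ 2 * 42)
    (lt_of_le_of_lt (measure_mono hsub) (volume_scaledSimplex_lt_top 42 Sc)).ne
    ((measurable_F0.pow_const 2).mul (measurable_Nbin_real hβ)).aestronglyMeasurable
    (Filter.Eventually.of_forall fun t => ?_)
  rw [Real.norm_eq_abs, abs_mul, abs_pow, Nat.abs_cast]
  exact mul_le_mul (pow_le_pow_left₀ (abs_nonneg _) (hC t) 2)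
    (by exact_mod_cast Nbin_le β t) (Nat.cast_nonneg _) (pow_nonneg hC0 2)

/-- The set whose `t'`-sections are measured by `ℓ_{mβ}(t')`. -/
def lenSet (m : Member) (β : Set ℝ) : Set ((Fin 41 → ℝ) × ℝ) :=
  {p | (p.2 ∈ β ∧ p.2 ∈ Icc (0 : ℝ) (Sc - ∑ j, p.1 j)) ∧ (Fin.cons p.2 p.1 : Fin 42 → ℝ) ∈ Esets m}

/-- `lenSet m β` is measurable for a measurable bin `β`. -/
theorem measurableSet_lenSet (m : Member) {β : Set ℝ} (hβ : MeasurableSet β) :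
    MeasurableSet (lenSet m β) := by
  unfold lenSet
  refine MeasurableSet.inter (MeasurableSet.inter (measurable_snd hβ) ?_) ?_
  · exact (measurableSet_le measurable_const measurable_snd).inter
      (measurableSet_le measurable_snd
        (measurable_const.sub ((measurable_sum_coord 41).comp measurable_fst)))
  · exact continuous_consMap.measurable (measurableSet_Esets m)

/-- `ℓ_{mβ}(t')` is the Lebesgue measure of the `t'`-section of `lenSet m β` (definitional). -/
theorem lenJI_eq (m : Member) (β : Set ℝ) (t' : Fin 41 → ℝ) :
    lenJI m β t' = (volume (Prod.mk t' ⁻¹' lenSet m β)).toReal := rfl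

/-- `ℓ_{mβ}` is measurable for every measurable bin `β`. -/
theorem measurable_lenJI (m : Member) {β : Set ℝ} (hβ : MeasurableSet β) :
    Measurable (lenJI m β) := by
  have h := (measurable_measure_prodMk_left (ν := (volume : Measure ℝ))
    (measurableSet_lenSet m hβ)).ennreal_toReal
  have e : lenJI m β = fun t' => (volume (Prod.mk t' ⁻¹' lenSet m β)).toReal :=
    funext (lenJI_eq m β)
  rw [e]
  exact h

/-- `0 ≤ ℓ_{mβ}(t') ≤ S` whenever `Σ t' ≥ 0`. -/
theorem lenJI_le (m : Member) (β : Set ℝ) {t' : Fin 41 → ℝ} (ht' : 0 ≤ ∑ j, t' j) :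
    lenJI m β t' ≤ Sc := by
  rw [lenJI_eq]
  have hsub : Prod.mk t' ⁻¹' lenSet m β ⊆ Icc 0 (Sc - ∑ j, t' j) := fun s hs => hs.1.2
  have h1 : volume (Prod.mk t' ⁻¹' lenSet m β) ≤ volume (Icc (0 : ℝ) (Sc - ∑ j, t' j)) :=
    measure_mono hsub
  have h2 : (volume (Icc (0 : ℝ) (Sc - ∑ j, t' j))).toReal ≤ Sc := by
    rw [Real.volume_Icc, ENNReal.toReal_ofReal']
    exact max_le (by linarith) Sc_pos.le
  exact le_trans (ENNReal.toReal_mono (by simp [Real.volume_Icc]) h1) h2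

/-- `Ω' ⊆ K·R₄₁`. -/
theorem OmegaG_subset : OmegaG ⊆ scaledSimplex 41 Kc := fun _ ht => ht.1

/-- The integrand of `Bval m β` is integrable on `Ω'`, for every measurable bin `β`. -/
theorem integrableOn_Bval (m : Member) {β : Set ℝ} (hβ : MeasurableSet β) :
    IntegrableOn (fun t' => F0marg t' ^ 2 * lenJI m β t') OmegaG := by
  obtain ⟨C, hC0, hC⟩ := exists_bound_F0marg
  refine Measure.integrableOn_of_bounded (M := C ^ 2 * Sc)
    (lt_of_le_of_lt (measure_mono OmegaG_subset) (volume_scaledSimplex_lt_top 41 Kc)).ne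
    ((measurable_F0marg.pow_const 2).mul (measurable_lenJI m hβ)).aestronglyMeasurable
    (ae_restrict_of_forall_mem measurableSet_OmegaG fun t' ht' => ?_)
  have hsum : 0 ≤ ∑ j, t' j := Finset.sum_nonneg fun j _ => (OmegaG_subset ht').1 j
  rw [Real.norm_eq_abs, abs_mul, abs_pow, abs_of_nonneg (lenJI_nonneg m β t')]
  exact mul_le_mul (pow_le_pow_left₀ (abs_nonneg _) (hC t') 2) (lenJI_le m β hsum)
    (lenJI_nonneg m β t') (pow_nonneg hC0 2)

/-- In particular, for the bins of any bin family (as in `crossOf`, `totalCross`). -/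
theorem integrableOn_Aval_binSet (m : Member) (mb : MemberBins (memberTau0 m)) (i : Fin mb.n) :
    IntegrableOn (fun t => F0 t ^ 2 * (Nbin (binSet mb i) t : ℝ)) (Esets m) :=
  integrableOn_Aval m (measurableSet_binSet mb i)

/-- The integrand `F0marg² · ℓ_{mβ_i}` of `Bval m β_i` is integrable on `Ω'` for every bin `β_i` of
any bin family on the member `m` (as in `crossOf`, `totalCross`). -/
theorem integrableOn_Bval_binSet (m : Member) (mb : MemberBins (memberTau0 m)) (i : Fin mb.n) :
    IntegrableOn (fun t' => F0marg t' ^ 2 * lenJI m (binSet mb i) t') OmegaG :=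
  integrableOn_Bval m (measurableSet_binSet mb i)

/-! ### Summary -/

/-- **Summary (referee point G1).** Every integral named by the certificate hypotheses (C1)–(C4) of
Corollary 6.4 (paper Appendix B) — `Ival`, `JKval`, `LGval`, and, for the bins
`β_i = [b_i, b_{i+1})` of any bin family on any cover member, `Aval m β_i` and `Bval m β_i` (the
summands of `crossOf`/`totalCross`) — is the Bochner integral of an integrable function on its
domain; in particular none of them is Mathlib's junk value for a non-integrable integrand. -/
theorem certificateIntegrands_integrable :
    Integrable (fun t => F0 t ^ 2) ∧
    IntegrableOn (fun t' => F0marg t' ^ 2) (scaledSimplex 41 Kc) ∧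
    IntegrableOn (fun t' => F0marg t' ^ 2) (scaledSimplex 41 Kc \ OmegaG) ∧
    (∀ (m : Member) (mb : MemberBins (memberTau0 m)) (i : Fin mb.n),
      IntegrableOn (fun t => F0 t ^ 2 * (Nbin (binSet mb i) t : ℝ)) (Esets m) ∧
      IntegrableOn (fun t' => F0marg t' ^ 2 * lenJI m (binSet mb i) t') OmegaG) :=
  ⟨integrable_F0_sq, integrableOn_JKval, integrableOn_LGval,
    fun m mb i => ⟨integrableOn_Aval_binSet m mb i, integrableOn_Bval_binSet m mb i⟩⟩

end

end Summit.Parity.GeneralizedHardyLittlewood.Theorems.Dhl42
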